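import Literature.Computability.AlgebraicComplexity.RankMethodBarriers
import Mathlib.RingTheory.MvPolynomial.Homogeneous
import Mathlib.LinearAlgebra.Dual.Lemmas
import Mathlib.Algebra.Polynomial.Roots
import Mathlib.Data.Nat.Choose.Sum
import HarnessLib

/-!
# Powers of linear forms span the forms of each degree (characteristic zero)

Topic `Literature/Computability/AlgebraicComplexity`; companion of `RankMethodBarriers.lean`
(`linearForm`, `linearPowers`). The classical fact behind Waring rank being defined for EVERY form
in characteristic zero (GMOW 2019, Def. 1.1/1.4: the simples `{ℓ^d : ℓ ∈ P(n,1)}` form "a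
spanning subset" of `P(n,d)`): over a field of characteristic zero every homogeneous polynomial of
degree `d` in `x₁, …, x_n` is a linear combination of `d`-th powers of linear forms
(`mem_span_linearPowers_of_isHomogeneous`).

Proof (polarisation by one variable at a time): if `m · ℓ_a^{D}` lies in the span `V` for all
linear forms `ℓ_a` and a fixed polynomial `m`, then so does `m · (ℓ_a + t x_i)^D` for all `t`;
the coefficients of this polynomial in `t` lie in `V` (a polynomial with coefficients in the
vector space `P/V` vanishing at infinitely many `t` is zero, `mem_of_forall_sum_pow_smul_mem`), and
the coefficient of `t^b` is `binom(D,b) · m x_i^b ℓ_a^{D-b}` with `binom(D,b) ≠ 0` in characteristic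
zero. Induction over the monomial (`monomial_mul_linearForm_pow_mem_span`) then puts every monomial
of degree `d` (times `ℓ^0 = 1`) in `V`.

## References

* [GargMakamOliveiraWigderson2019] A. Garg, V. Makam, R. Oliveira, A. Wigderson, *More barriers
  for rank methods, via a "numeric to symbolic" transfer*, FOCS 2019 (arXiv:1904.04299), Def. 1.1,
  Def. 1.4, Ex. 1.5.
* [EfremenkoGargOliveiraWigderson2018] Def. 4.1 (Waring rank).
-/

noncomputable section

open scoped BigOperators
open MvPolynomial

namespace Literature.Computability.AlgebraicComplexity

variable {F : Type*} [Field F] {n : ℕ}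

/-- `ℓ_{a+b} = ℓ_a + ℓ_b`. [folklore] -/
theorem linearForm_add (a b : Fin n → F) : linearForm (a + b) = linearForm a + linearForm b := by
  simp only [linearForm, Pi.add_apply, C_add, add_mul]
  rw [Finset.sum_add_distrib]

/-- `ℓ_{t e_i} = t x_i`. [folklore] -/
theorem linearForm_single_smul (i : Fin n) (t : F) :
    linearForm (Pi.single i t : Fin n → F) = C t * X i := by
  classical
  unfold linearForm
  rw [Finset.sum_eq_single i]
  · rw [Pi.single_eq_same]
  · intro j _ hj
    rw [Pi.single_eq_of_ne hj, C_0, zero_mul]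
  · intro h
    exact absurd (Finset.mem_univ i) h

/-- A polynomial in `t` with coefficients in a vector space over an infinite field which takes
values in a subspace `V` for every `t` has all its coefficients in `V`. [folklore] -/
theorem mem_of_forall_sum_pow_smul_mem {M : Type*} [AddCommGroup M] [Module F M] [Infinite F]
    (V : Submodule F M) {N : ℕ} (v : ℕ → M)
    (h : ∀ t : F, ∑ s ∈ Finset.range (N + 1), t ^ s • v s ∈ V) {s : ℕ} (hs : s ≤ N) :
    v s ∈ V := by
  rw [← Submodule.Quotient.mk_eq_zero, ← Submodule.mkQ_apply]
  refine (Module.forall_dual_apply_eq_zero_iff F _).1 fun g => ?_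
  set P : Polynomial F :=
    ∑ s ∈ Finset.range (N + 1), Polynomial.C (g (V.mkQ (v s))) * Polynomial.X ^ s
    with hP_def
  have hP : P = 0 := by
    apply Polynomial.funext
    intro t
    have ht : V.mkQ (∑ s ∈ Finset.range (N + 1), t ^ s • v s) = 0 :=
      (Submodule.Quotient.mk_eq_zero V).2 (h t)
    rw [map_sum] at ht
    have hgt := congrArg g ht
    rw [map_sum, map_zero] at hgt
    simp only [hP_def, Polynomial.eval_finsetSum, Polynomial.eval_mul, Polynomial.eval_C,
      Polynomial.eval_pow, Polynomial.eval_X, Polynomial.eval_zero]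
    rw [← hgt]
    refine Finset.sum_congr rfl fun s _ => ?_
    rw [map_smul, map_smul, smul_eq_mul, mul_comm]
  have hcoeff := congrArg (fun Q : Polynomial F => Q.coeff s) hP
  simp only [hP_def, Polynomial.finsetSum_coeff, Polynomial.coeff_C_mul_X_pow,
    Polynomial.coeff_zero] at hcoeff
  rw [Finset.sum_eq_single s, if_pos rfl] at hcoeff
  · exact hcoeff
  · intro s' _ hs'
    rw [if_neg (Ne.symm hs')]
  · intro hs'
    exact absurd (Finset.mem_range.2 (Nat.lt_succ_of_le hs)) hs'

/-- Polarisation step: every `x^e · ℓ_a^{d - |e|}` (`|e| ≤ d`, `ℓ_a` a linear form) lies in the span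
of the `d`-th powers of linear forms (characteristic zero). [folklore] -/
theorem monomial_mul_linearForm_pow_mem_span [CharZero F] (d : ℕ) (e : Fin n →₀ ℕ)
    (he : e.degree ≤ d) (a : Fin n → F) :
    monomial e (1 : F) * linearForm a ^ (d - e.degree) ∈
      Submodule.span F (linearPowers F n d) := by
  classical
  haveI : Infinite F := Infinite.of_injective (Nat.cast : ℕ → F) Nat.cast_injective
  set V := Submodule.span F (linearPowers F n d) with hV
  induction e using Finsupp.induction generalizing a with
  | zero =>
    rw [map_zero, Nat.sub_zero, monomial_zero', C_1, one_mul]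
    exact Submodule.subset_span ⟨a, rfl⟩
  | single_add i b e' hi hb ih =>
    -- degrees
    have hdeg : (Finsupp.single i b + e').degree = b + e'.degree := by
      rw [map_add, Finsupp.degree_single]
    rw [hdeg] at he ⊢
    set D := d - e'.degree with hD
    have hbD : b ≤ D := by omega
    have hsub : d - (b + e'.degree) = D - b := by omega
    rw [hsub]
    -- the family of coefficients of `x^{e'} (ℓ_a + t x_i)^D` as a polynomial in `t`
    set v : ℕ → MvPolynomial (Fin n) F := fun s =>
      C ((D.choose s : ℕ) : F) * (monomial e' (1 : F) * X i ^ s * linearForm a ^ (D - s)) with hv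
    have hmem : ∀ t : F, ∑ s ∈ Finset.range (D + 1), t ^ s • v s ∈ V := by
      intro t
      have h1 := ih (by omega) (a + Pi.single i t)
      rw [linearForm_add, linearForm_single_smul, add_comm (linearForm a), add_pow,
        Finset.mul_sum] at h1
      convert h1 using 1
      refine Finset.sum_congr rfl fun s _ => ?_
      rw [smul_eq_C_mul, hv, mul_pow, ← C_pow, ← map_natCast (C : F →+* MvPolynomial (Fin n) F)]
      ring
    have hvb : v b ∈ V := mem_of_forall_sum_pow_smul_mem V v hmem hbD
    have hc : ((D.choose b : ℕ) : F) ≠ 0 := by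
      exact_mod_cast (Nat.choose_pos hbD).ne'
    have := V.smul_mem ((D.choose b : ℕ) : F)⁻¹ hvb
    rw [hv, smul_eq_C_mul, ← mul_assoc, ← C_mul, inv_mul_cancel₀ hc, C_1, one_mul] at this
    convert this using 1
    rw [X_pow_eq_monomial, monomial_mul, one_mul, add_comm e']

/-- **Powers of linear forms span the forms.** Over a field of characteristic zero every
homogeneous polynomial of degree `d` in `n` variables is a linear combination of `d`-th powers of
linear forms `(∑ aᵢ xᵢ)^d` — the simples of Waring rank span `P(n,d)` (the standing
"spanning subset" requirement of GMOW 2019, Def. 1.1, in the instance Def. 1.4). [folklore] -/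
theorem mem_span_linearPowers_of_isHomogeneous [CharZero F] {d : ℕ} {f : MvPolynomial (Fin n) F}
    (hf : f.IsHomogeneous d) : f ∈ Submodule.span F (linearPowers F n d) := by
  classical
  rw [f.as_sum]
  refine Submodule.sum_mem _ fun e he => ?_
  have hdeg : e.degree = d := by
    by_contra hne
    exact (mem_support_iff.1 he) (hf.coeff_eq_zero hne)
  have h1 := monomial_mul_linearForm_pow_mem_span d e hdeg.le (0 : Fin n → F)
  rw [hdeg, Nat.sub_self, pow_zero, mul_one] at h1
  have h2 := (Submodule.span F (linearPowers F n d)).smul_mem (coeff e f) h1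
  rwa [smul_monomial, smul_eq_mul, mul_one] at h2

/-- The span of the `d`-th powers of linear forms is exactly the space of forms of degree `d`
(characteristic zero). [folklore] -/
theorem span_linearPowers_eq_homogeneousSubmodule [CharZero F] (d : ℕ) :
    Submodule.span F (linearPowers F n d) = homogeneousSubmodule (Fin n) F d := by
  refine le_antisymm (Submodule.span_le.2 ?_) fun f hf => mem_span_linearPowers_of_isHomogeneous hf
  rintro _ ⟨a, rfl⟩
  change (linearForm a ^ d).IsHomogeneous d
  have h1 : (linearForm a).IsHomogeneous 1 := by
    unfold linearForm
    exact IsHomogeneous.sum _ _ _ fun i _ => (isHomogeneous_X F i).C_mul (a i)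
  simpa using h1.pow d

end Literature.Computability.AlgebraicComplexity
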